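import Literature.NumberTheory.EllipticCurves.CMNewformGamma0LevelSquarefull
import Literature.NumberTheory.EllipticCurves.SharpFlatPAdicLFunctionCoeffField
import Mathlib.NumberTheory.Padics.Complex
import HarnessLib

/-!
# The LEVEL BRACKET of RSL_g's exponent `Σ_g(S₀)` is level-exact at `p = 2`, and vanishes under LVsq
# (`[‖ι a_ℓ(g) − 1‖₂ < 1] = [¬ ℓ² ∣ M]` at `ℓ ∣ M`; under «`ℓ ∣ M ⟹ ℓ² ∣ M`» the `S₀`-sum is its good-place part)

Route `ResidualThetaTransportAtTwo` (RTT), crux RSL_g `ResidualSignedLambdaLowerCMAtTwo` (stmt-BirchSwinnertonDyer-22608); width seat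
`prover-bsd-wall-tp2-p2x-w3` g15 (`--supports 22608 --as helper`, closes nothing). THEOREMS ONLY (no definition, no named fact, no instance,
no `sorry`). Stub plan rev 17 trap T42 / placement S68 / request Q71 (kernel half): card `Ideas/stub-cmlambdalower-k4-g13.md`, sketch
`Cruxes/ResidualThetaCountLowerPureAtTwo/Sketch_sidea_k4_g13.lean` §A and §C transcribed over a GENERIC place-to-prime map `ℓ : α → ℕ`
(instantiate `ℓ := natGenerator`; the summand below is RSL_g's, route file `Theses/ResidualThetaTransportAtTwo.lean` l. 508, VERBATIM) and
with the sketch's `def sigmaSummand` inlined (credit: stub-ideation k4 g13; the LV0 form is idea k4-g5's H-B1, cf. k4-g6, k4-g8).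
The print input LVsq («a CM newform on `Γ₀(M)` has `ℓ² ∣ M` at every `ℓ ∣ M`», Ribet 1977) enters either as the local hypothesis `hsq` or,
in the `_of_cm` forms, as the NAMED FACT `ModularForms.cmNewform_gamma0_sq_dvd_level` (`Literature/…/CMNewformGamma0LevelSquarefull.lean`)
applied to a CM newform — the conditional shape of the print stub `stub_cmLevelSquarefull` (S68).

* `levelBracket_eq_zero_of_sq_dvd`, `levelBracket_eq_one_of_not_sq_dvd`, `levelBracket_eq` — for a weight-two `Γ₀(M)`-newform and `ℓ ∣ M`:
  `(if ‖embCoeff g ι ℓ - 1‖ < 1 then 1 else 0) = if ℓ ^ 2 ∣ M then 0 else 1` (Atkin–Lehner `a_ℓ ∈ {0, ±1}` + `‖2‖₂ < 1`).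
* `sigmaSummand_level_eq`, `sigmaSummand_eq_zero_of_sq_dvd` — RSL_g's summand at a level prime is `2^{n_ℓ}·[¬ ℓ² ∣ M]`, hence `0` under `hsq`.
* `sigma_eq_sum_filter_not_dvd` — under `hsq` the exponent `∑_{v ∈ S₀} …` equals its sum over the GOOD places `{v ∈ S₀ : ¬ ℓ_v ∣ M}` (the uniform
  road: no kernel split stub's demand mentions a level prime's bracket — S68).
* `sigma_eq_sum_good_of_cm` — the same with `hsq` supplied by the named fact `cmNewform_gamma0_sq_dvd_level` for a CM newform `g`.
* `one_le_sigmaSummand_of_not_sq_dvd`, `lt_sigma_of_not_sq_dvd` — the T42 witness: a place with `ℓ ∥ M` contributes `2^{n_ℓ} ≥ 1`.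

References: [AtkinLehner1970] Thm. 3; [Knapp1993] Thm. 9.27 (`a_p = −λ_p` at `p ∥ N`); [Ribet1977Nebentypus] §3 Cor. (3.5), §4 Thm. (4.5) (LVsq).
BSD is not proved by any of this; RSL_g (22608) is not proved here.
-/

set_option autoImplicit false
-- the Theorems namespace of this sub repeats the summit name by design (D-0017 nested layout)
set_option linter.dupNamespace false

noncomputable section

open scoped MatrixGroups ModularForm
open CongruenceSubgroup Literature.NumberTheory.EllipticCurves Literature.NumberTheory.EllipticCurves.ModularForms

namespace Summit.BirchSwinnertonDyer.BirchSwinnertonDyer.Theorems.LevelBracket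

variable {M : ℕ} [NeZero M] {g : CuspForm (Gamma0 M) 2} (ι : coeffField g →+* PadicAlgCl 2)

/-! ## §1 The level bracket is level-exact at `p = 2` -/

/-- `ℓ² ∣ M` ⇒ `ι a_ℓ = 0` ⇒ `‖ι a_ℓ − 1‖ = 1`: the bracket is `0`. Credit: card k4-g13 §A. [cite: AtkinLehner1970, Thm. 3] -/
theorem levelBracket_eq_zero_of_sq_dvd (hg : IsNewform0 g) {ℓ : ℕ} (hℓ : ℓ.Prime) (h2 : ℓ ^ 2 ∣ M) :
    (if ‖embCoeff g ι ℓ - 1‖ < 1 then 1 else 0 : ℕ) = 0 := by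
  have h0 : embCoeff g ι ℓ = (0 : ℤ) :=
    embCoeff_eq_intCast g ι (a := 0) (by simpa using hg.cuspCoeff_eq_zero_of_sq_dvd hℓ h2)
  simp [h0]

/-- `ℓ ∥ M` ⇒ `ι a_ℓ = ±1` ⇒ `‖ι a_ℓ − 1‖ ∈ {0, ‖2‖₂ = ½}`: the bracket is `1` (`p = 2` is essential: at odd `p` only `a_ℓ = +1` would fire).
Credit: card k4-g13 §A. [cite: AtkinLehner1970, Thm. 3] [cite: Knapp1993, Thm. 9.27] -/
theorem levelBracket_eq_one_of_not_sq_dvd (hg : IsNewform0 g) {ℓ : ℕ} (hℓ : ℓ.Prime) (hℓM : ℓ ∣ M) (h2 : ¬ ℓ ^ 2 ∣ M) :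
    (if ‖embCoeff g ι ℓ - 1‖ < 1 then 1 else 0 : ℕ) = 1 := by
  rcases hg.cuspCoeff_eq_one_or_eq_neg_one hℓ hℓM h2 with h | h
  · have h1 : embCoeff g ι ℓ = (1 : ℤ) := embCoeff_eq_intCast g ι (a := 1) (by simpa using h)
    simp [h1]
  · have h1 : embCoeff g ι ℓ = (-1 : ℤ) := embCoeff_eq_intCast g ι (a := -1) (by simpa using h)
    have hn : ‖embCoeff g ι ℓ - 1‖ < 1 := by
      -- `‖2‖₂ = 1/2 < 1` (cf. the tree's `ThetaLayerLambdaCongruenceAtTwo.norm_two_padicAlgCl_lt_one`)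
      have h2F : (algebraMap ℚ_[2] (PadicAlgCl 2)) 2 = (2 : PadicAlgCl 2) := map_ofNat _ 2
      have h2n : ‖(2 : ℚ_[2])‖ = (2 : ℝ)⁻¹ := by exact_mod_cast Padic.norm_p (p := 2)
      rw [h1, Int.cast_neg, Int.cast_one, show (-1 : PadicAlgCl 2) - 1 = -2 by norm_num, norm_neg, ← h2F, PadicAlgCl.norm_extends, h2n]
      norm_num
    simp [hn]

/-- **The level bracket is LEVEL-EXACT at `p = 2`.** For a weight-two `Γ₀(M)`-newform and a level prime `ℓ ∣ M`:
`[‖ι a_ℓ − 1‖₂ < 1] = [¬ ℓ² ∣ M]`. No CM hypothesis; the bracket is not dead code (it is vacuous only under LVsq). Credit: card k4-g13 §A (F1).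
[cite: AtkinLehner1970, Thm. 3] [cite: Knapp1993, Thm. 9.27] -/
theorem levelBracket_eq (hg : IsNewform0 g) {ℓ : ℕ} (hℓ : ℓ.Prime) (hℓM : ℓ ∣ M) :
    (if ‖embCoeff g ι ℓ - 1‖ < 1 then 1 else 0 : ℕ) = if ℓ ^ 2 ∣ M then 0 else 1 := by
  by_cases h2 : ℓ ^ 2 ∣ M
  · rw [if_pos h2]; exact levelBracket_eq_zero_of_sq_dvd ι hg hℓ h2
  · rw [if_neg h2]; exact levelBracket_eq_one_of_not_sq_dvd ι hg hℓ hℓM h2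

/-! ## §2 Consequences for RSL_g's exponent `Σ_g(S₀)` (the summand of the route file, verbatim, at the prime `ℓ` of a place) -/

/-- **RSL_g's summand at a LEVEL prime is `2^{n_ℓ}·[¬ ℓ² ∣ M]`** — computable from `M` alone. Credit: card k4-g13 §C (`sigmaSummand_eq`).
[cite: AtkinLehner1970, Thm. 3] -/
theorem sigmaSummand_level_eq (hg : IsNewform0 g) {ℓ : ℕ} (hℓ : ℓ.Prime) (hℓM : ℓ ∣ M) :
    2 ^ padicValNat 2 ((ℓ ^ 2 - 1) / 8) *
        (if ℓ ∣ M then (if ‖embCoeff g ι ℓ - 1‖ < 1 then 1 else 0) else (if ‖embCoeff g ι ℓ‖ < 1 then 2 else 0)) =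
      2 ^ padicValNat 2 ((ℓ ^ 2 - 1) / 8) * (if ℓ ^ 2 ∣ M then 0 else 1) := by
  rw [if_pos hℓM, levelBracket_eq ι hg hℓ hℓM]

/-- **Under LVsq (local hypothesis `hsq : ∀ ℓ ∣ M, ℓ² ∣ M`) every level summand of RSL_g's exponent VANISHES** (the uniform road).
Credit: card k4-g13 §C. [cite: AtkinLehner1970, Thm. 3] [cite: Ribet1977Nebentypus, §4 Thm. (4.5) with §3 Cor. (3.5)] -/
theorem sigmaSummand_eq_zero_of_sq_dvd (hg : IsNewform0 g) (hsq : ∀ ℓ : ℕ, ℓ.Prime → ℓ ∣ M → ℓ ^ 2 ∣ M) {ℓ : ℕ} (hℓ : ℓ.Prime)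
    (hℓM : ℓ ∣ M) :
    2 ^ padicValNat 2 ((ℓ ^ 2 - 1) / 8) *
        (if ℓ ∣ M then (if ‖embCoeff g ι ℓ - 1‖ < 1 then 1 else 0) else (if ‖embCoeff g ι ℓ‖ < 1 then 2 else 0)) = 0 := by
  rw [sigmaSummand_level_eq ι hg hℓ hℓM, if_pos (hsq ℓ hℓ hℓM), mul_zero]

/-- **Under LVsq the exponent is its GOOD part**: for any finite set of places `S₀` with prime map `ℓ` (instantiate `ℓ := natGenerator`),
`∑_{v ∈ S₀} 2^{n_v}·(bracket) = ∑_{v ∈ S₀, ¬ ℓ_v ∣ M} 2^{n_v}·(bracket)` — so a split stub's DEMAND side never has to mention a level prime's bracket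
(stub plan rev 17 S68; level primes stay in `S₀` as relaxed places). Credit: card k4-g13 §C (`sigma_eq_good_part`).
[cite: AtkinLehner1970, Thm. 3] [cite: Ribet1977Nebentypus, §4 Thm. (4.5) with §3 Cor. (3.5)] -/
theorem sigma_eq_sum_filter_not_dvd {α : Type*} (S₀ : Finset α) (ℓ : α → ℕ) (hprime : ∀ v ∈ S₀, (ℓ v).Prime) (hg : IsNewform0 g)
    (hsq : ∀ q : ℕ, q.Prime → q ∣ M → q ^ 2 ∣ M) :
    ∑ v ∈ S₀, 2 ^ padicValNat 2 ((ℓ v ^ 2 - 1) / 8) *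
        (if ℓ v ∣ M then (if ‖embCoeff g ι (ℓ v) - 1‖ < 1 then 1 else 0) else (if ‖embCoeff g ι (ℓ v)‖ < 1 then 2 else 0)) =
      ∑ v ∈ S₀ with ¬ ℓ v ∣ M, 2 ^ padicValNat 2 ((ℓ v ^ 2 - 1) / 8) *
        (if ℓ v ∣ M then (if ‖embCoeff g ι (ℓ v) - 1‖ < 1 then 1 else 0) else (if ‖embCoeff g ι (ℓ v)‖ < 1 then 2 else 0)) := by
  rw [Finset.sum_filter]
  refine Finset.sum_congr rfl fun v hv ↦ ?_
  by_cases h : ℓ v ∣ M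
  · rw [if_neg (not_not.2 h)]
    exact sigmaSummand_eq_zero_of_sq_dvd ι hg hsq (hprime v hv) h
  · rw [if_pos h]

/-- … and on the good places the summand reads `2^{n_v}·(if ‖ι a_{ℓ_v}‖ < 1 then 2 else 0)` (the level branch is gone): the exponent in the form the
good-place count consumes. Credit: card k4-g13 §C. [cite: AtkinLehner1970, Thm. 3] [cite: Ribet1977Nebentypus, §4 Thm. (4.5) with §3 Cor. (3.5)] -/
theorem sigma_eq_sum_good {α : Type*} (S₀ : Finset α) (ℓ : α → ℕ) (hprime : ∀ v ∈ S₀, (ℓ v).Prime) (hg : IsNewform0 g)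
    (hsq : ∀ q : ℕ, q.Prime → q ∣ M → q ^ 2 ∣ M) :
    ∑ v ∈ S₀, 2 ^ padicValNat 2 ((ℓ v ^ 2 - 1) / 8) *
        (if ℓ v ∣ M then (if ‖embCoeff g ι (ℓ v) - 1‖ < 1 then 1 else 0) else (if ‖embCoeff g ι (ℓ v)‖ < 1 then 2 else 0)) =
      ∑ v ∈ S₀ with ¬ ℓ v ∣ M, 2 ^ padicValNat 2 ((ℓ v ^ 2 - 1) / 8) * (if ‖embCoeff g ι (ℓ v)‖ < 1 then 2 else 0) := by
  rw [sigma_eq_sum_filter_not_dvd ι S₀ ℓ hprime hg hsq]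
  refine Finset.sum_congr rfl fun v hv ↦ ?_
  rw [Finset.mem_filter] at hv
  rw [if_neg hv.2]

/-- **The exponent of a CM newform is its good-place part, modulo the named print fact LVsq** (`cmNewform_gamma0_sq_dvd_level`, Ribet 1977):
the shape in which the split glue of `Lines/onepair.lean` consumes its print stub `stub_cmLevelSquarefull` (stub plan rev 17 S68) — instantiate
`ℓ := natGenerator`. [cite: Ribet1977Nebentypus, §4 Thm. (4.5) with §3 Cor. (3.5)] [cite: AtkinLehner1970, Thm. 3] -/
theorem sigma_eq_sum_good_of_cm (hLV : cmNewform_gamma0_sq_dvd_level) {α : Type*} (S₀ : Finset α) (ℓ : α → ℕ)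
    (hprime : ∀ v ∈ S₀, (ℓ v).Prime) (hg : IsNewform0 g) (hcm : Literature.NumberTheory.Automorphic.IsCMForm (liftToGamma1 M 2 g)) :
    ∑ v ∈ S₀, 2 ^ padicValNat 2 ((ℓ v ^ 2 - 1) / 8) *
        (if ℓ v ∣ M then (if ‖embCoeff g ι (ℓ v) - 1‖ < 1 then 1 else 0) else (if ‖embCoeff g ι (ℓ v)‖ < 1 then 2 else 0)) =
      ∑ v ∈ S₀ with ¬ ℓ v ∣ M, 2 ^ padicValNat 2 ((ℓ v ^ 2 - 1) / 8) * (if ‖embCoeff g ι (ℓ v)‖ < 1 then 2 else 0) :=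
  sigma_eq_sum_good ι S₀ ℓ hprime hg (hLV M g hg hcm)

/-- **The T42 witness (assume the opposite).** If some prime `ℓ ∥ M` (exactly), its summand is `2^{n_ℓ} ≥ 1`: a positive demand about which no
binder of RSL_g speaks. Credit: card k4-g13 §C (F2). [cite: AtkinLehner1970, Thm. 3] [cite: Knapp1993, Thm. 9.27] -/
theorem one_le_sigmaSummand_of_not_sq_dvd (hg : IsNewform0 g) {ℓ : ℕ} (hℓ : ℓ.Prime) (hℓM : ℓ ∣ M) (h2 : ¬ ℓ ^ 2 ∣ M) :
    1 ≤ 2 ^ padicValNat 2 ((ℓ ^ 2 - 1) / 8) *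
        (if ℓ ∣ M then (if ‖embCoeff g ι ℓ - 1‖ < 1 then 1 else 0) else (if ‖embCoeff g ι ℓ‖ < 1 then 2 else 0)) := by
  rw [sigmaSummand_level_eq ι hg hℓ hℓM, if_neg h2, mul_one]
  exact Nat.one_le_two_pow

/-- … so RSL_g's exponent exceeds `d` as soon as ONE place of `S₀` has `ℓ ∥ M` (and RSL_g's binder `(∀ v, natGenerator v ∣ M → v ∈ S₀)` puts every
level prime in `S₀`). Credit: card k4-g13 §C. [cite: AtkinLehner1970, Thm. 3] [cite: Knapp1993, Thm. 9.27] -/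
theorem lt_sigma_of_not_sq_dvd {α : Type*} (S₀ : Finset α) (ℓ : α → ℕ) (hg : IsNewform0 g) {v : α} (hv : v ∈ S₀) (hℓ : (ℓ v).Prime)
    (hℓM : ℓ v ∣ M) (h2 : ¬ ℓ v ^ 2 ∣ M) (d : ℕ) :
    d < d + ∑ w ∈ S₀, 2 ^ padicValNat 2 ((ℓ w ^ 2 - 1) / 8) *
        (if ℓ w ∣ M then (if ‖embCoeff g ι (ℓ w) - 1‖ < 1 then 1 else 0) else (if ‖embCoeff g ι (ℓ w)‖ < 1 then 2 else 0)) := by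
  have h1 := one_le_sigmaSummand_of_not_sq_dvd ι hg hℓ hℓM h2
  have h2' : 2 ^ padicValNat 2 ((ℓ v ^ 2 - 1) / 8) *
        (if ℓ v ∣ M then (if ‖embCoeff g ι (ℓ v) - 1‖ < 1 then 1 else 0) else (if ‖embCoeff g ι (ℓ v)‖ < 1 then 2 else 0)) ≤
      ∑ w ∈ S₀, 2 ^ padicValNat 2 ((ℓ w ^ 2 - 1) / 8) *
        (if ℓ w ∣ M then (if ‖embCoeff g ι (ℓ w) - 1‖ < 1 then 1 else 0) else (if ‖embCoeff g ι (ℓ w)‖ < 1 then 2 else 0)) :=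
    Finset.single_le_sum (f := fun w ↦ 2 ^ padicValNat 2 ((ℓ w ^ 2 - 1) / 8) *
        (if ℓ w ∣ M then (if ‖embCoeff g ι (ℓ w) - 1‖ < 1 then 1 else 0) else (if ‖embCoeff g ι (ℓ w)‖ < 1 then 2 else 0)))
      (fun _ _ ↦ Nat.zero_le _) hv
  omega

end Summit.BirchSwinnertonDyer.BirchSwinnertonDyer.Theorems.LevelBracket

end
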